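import Mathlib
import HarnessLib
import Summits.HubbardSuperconductivity.HubbardSuperconductivity.Theorems.KLProgrammePolarRayCoareaReframe
import Summits.HubbardSuperconductivity.HubbardSuperconductivity.Theorems.KLProgrammeLatticeMatsubaraBubble

/-!
# Route `KLProgramme` — K3 ENGINE child (stmt-HubbardSuperconductivity-20437 `KLRegimeEngineV17F2`), class #5 rev 3 (RELATIVE, cutoff-built family),
# the (F)(i) RE-FRAMING door, brick (Fb): THE PLANAR RE-FRAMING INEQUALITY for a LEVEL-BUILT integrand (cell gate-hubbard-kl, seat hubbard-kl-k3c2-p2 g13;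
# plan g21 (R54t)(3) «(F) pricing»; KLTC-INDEX-v7 §C «(F)(i) re-framing value door [k3c2-p2/p2]»)

Companion of `…PolarRayCoareaReframe` ((Fa): the level map, the transversal slope and the Jacobian of two admissible frames `δ, δ′` differ by `O(‖δ − δ′‖)`).
Here the planar consequence: two continuous compactly supported planar integrands `h, h′`, supported in the open square and in the tubes of the two frames,
LEVEL-BUILT with the SAME frame-independent profile `f` — `h(t·(cos θ, sin θ)) = f θ ((ε₀ + δ − μ)(t·dir θ)) • F(t·(cos θ, sin θ))`, `h′` likewise with
`δ′, F′` — have planar integrals differing by at most `2π·m_f·(C_𝒥·B_F + (π√2/d)·(L_F·η/d + η_F))`, where `m_f` bounds the profile's LEVEL MASS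
`∫_{−ē}^{ē} |f θ e| de`, `B_F`/`L_F` are the sup/Lipschitz constants of the non-level factor `F`, `η_F` bounds `‖F − F′‖` (the frame modulus of the
non-level factor — the p2 lineage's half for the running arrays), `C_𝒥 = (1/d² + π√2(2+κ₂)/d³)·η + (π√2/d²)·η₁` (`klrg_jacobian_reframe`), `d = Dt_min − κ₁`:

* `klrg_ray_integrable` — the ray function `t ↦ t • h(t cos θ, t sin θ)` of a continuous compactly supported `h` is integrable;
* `klrg_ray_eq_level` — ONE ray in the frame's level coordinates (per-angle form of `klrf_integral_eq_frame_level_coords`);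
* `klrg_level_integrand_continuousOn` — the level-coordinate integrand is continuous on `[−ē, ē]`;
* **`klrg_integral_reframe_norm_sub_le`** — THE INEQUALITY: the profile is never differentiated, so the re-framing defect of a cutoff-built member's smeared
  loop is ∝ its own soft mass, uniformly in the member's depth (the (F) PRICE of KL STATUS 2026-08-28 ≈00:24Z, in Lean).
The lattice twin (Fc) (Riemann passage `klfl_latticeAverage_sub_integral_norm_le` ×2, or the EdgeFacts level count) and the instantiation on the member arrays
`klMemberArrayF` are T+ items.

Pure analysis on the tree's objects; no definitions; nothing about the model is asserted; nothing asserts superconductivity.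
References: BGM 2006 §2.4 Lemma 2.1, §2.5 (2.56b) [cite: BenfattoGiulianiMastropietro2006].
-/

noncomputable section

namespace Summit.HubbardSuperconductivity.HubbardSuperconductivity.Theorems.KLRegimeSplit

set_option linter.dupNamespace false -- summit = problem name (single-conjunct summit), D-0017

open Real Set Filter Literature.MathematicalPhysics.QuantumLattice
open Literature.MathematicalPhysics.QuantumLattice.BandSectorCounting
open Summit.HubbardSuperconductivity.HubbardSuperconductivity.Theorems.PerturbedFermiCurve

/-! ## §1 Ray plumbing and the inequality -/

section Planar

open MeasureTheory intervalIntegral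

variable {E' : Type*} [NormedAddCommGroup E'] [NormedSpace ℝ E']

/-- `max |cos θ| |sin θ| ≥ 1/2` (crude; `cos² + sin² = 1`). -/
theorem klrg_half_le_max_abs_cos_sin (θ : ℝ) : 1 / 2 ≤ max |Real.cos θ| |Real.sin θ| := by
  by_contra h
  push Not at h
  have hc := (max_lt_iff.mp h).1
  have hs := (max_lt_iff.mp h).2
  have h1 := Real.cos_sq_add_sin_sq θ
  nlinarith [abs_nonneg (Real.cos θ), abs_nonneg (Real.sin θ), sq_abs (Real.cos θ), sq_abs (Real.sin θ)]

/-- **The ray function `t ↦ t • h(t cos θ, t sin θ)` of a continuous compactly supported `h` is integrable.** -/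
theorem klrg_ray_integrable {h : ℝ × ℝ → E'} (hc : Continuous h) (hcs : HasCompactSupport h) (θ : ℝ) :
    Integrable (fun t : ℝ => t • h (t * Real.cos θ, t * Real.sin θ)) := by
  have hlin : Continuous (fun t : ℝ => ((t * Real.cos θ, t * Real.sin θ) : ℝ × ℝ)) := by fun_prop
  have hcont : Continuous (fun t : ℝ => t • h (t * Real.cos θ, t * Real.sin θ)) := continuous_id.smul (hc.comp hlin)
  obtain ⟨R, hR, hzero⟩ := hcs.exists_pos_le_norm
  refine hcont.integrable_of_hasCompactSupport (HasCompactSupport.intro (isCompact_Icc : IsCompact (Icc (-(2 * R)) (2 * R))) ?_)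
  intro t ht
  rw [mem_Icc, not_and_or, not_le, not_le] at ht
  have ht2 : 2 * R < |t| := by
    rcases ht with ht | ht
    · rw [abs_of_neg (by linarith)]; linarith
    · rw [abs_of_pos (by linarith)]; exact ht
  have hnorm : R ≤ ‖((t * Real.cos θ, t * Real.sin θ) : ℝ × ℝ)‖ := by
    rw [Prod.norm_def, Real.norm_eq_abs, Real.norm_eq_abs, abs_mul, abs_mul, ← mul_max_of_nonneg _ _ (abs_nonneg t)]
    have := klrg_half_le_max_abs_cos_sin θ
    nlinarith [abs_nonneg t]
  rw [hzero _ hnorm, smul_zero]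

variable {a b : ℝ} (B : BandBounds a b) {δ : (Fin 2 → ℝ) → ℝ} (hδ1 : ContDiff ℝ 1 δ) {κ₀ κ₁ : ℝ}
  (hδ : ∀ k : Fin 2 → ℝ, (∀ i, |k i| ≤ π) → |δ k| ≤ κ₀)
  (hκ : ∀ k : Fin 2 → ℝ, (∀ i, |k i| ≤ π) → ‖fderiv ℝ δ k‖ ≤ κ₁) (hκ₁ : κ₁ < B.Dtmin)

include B hδ1 hδ hκ hκ₁ in
/-- **One ray in the frame's level coordinates** (the per-angle form of `klrf_integral_eq_frame_level_coords`): for `h` continuous, supported in the open square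
and in the tube `|ε₀ + δ − μ| < ē` (margin window), and `θ ∈ (−π, π)`,
`∫_{t>0} t • h(t cos θ, t sin θ) dt = ∫_{e ∈ −ē..ē} 𝒥_E(θ,e) • h(u_E(μ+e,θ) cos θ, u_E(μ+e,θ) sin θ) de`. -/
theorem klrg_ray_eq_level {h : ℝ × ℝ → E'} (hc : Continuous h) {μ ē : ℝ} (hē : 0 ≤ ē) (hlo : a < μ - ē - κ₀) (hhi : μ + ē + κ₀ < b)
    (hsupp : ∀ p : ℝ × ℝ, h p ≠ 0 → |p.1| < π ∧ |p.2| < π ∧ |sqDispersion ![p.1, p.2] + δ ![p.1, p.2] - μ| < ē) (θ : ℝ) :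
    ∫ t in Ioi (0 : ℝ), t • h (t * Real.cos θ, t * Real.sin θ) = ∫ e in (-ē)..ē,
      (perturbedFermiRadius δ (μ + e) θ *
          (rayDispersionDt θ (perturbedFermiRadius δ (μ + e) θ) +
            fderiv ℝ δ (perturbedFermiRadius δ (μ + e) θ • dir θ) (dir θ))⁻¹) •
        h (perturbedFermiRadius δ (μ + e) θ * Real.cos θ, perturbedFermiRadius δ (μ + e) θ * Real.sin θ) := by
  have hδc : Continuous δ := hδ1.continuous
  have hneg : μ + -ē = μ - ē := by ring
  refine klry_ray_substitution hc hē (ρ := fun e => perturbedFermiRadius δ (μ + e) θ)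
    (ρ' := fun e => (rayDispersionDt θ (perturbedFermiRadius δ (μ + e) θ) +
      fderiv ℝ δ (perturbedFermiRadius δ (μ + e) θ • dir θ) (dir θ))⁻¹) ?_ ?_ ?_ ?_ ?_
  · intro e he
    have hd := klrf_hasDerivAt_level B hδ1 hδ hκ hκ₁ (ν := μ + e) (by linarith [he.1]) (by linarith [he.2]) θ
    have h2' : HasDerivAt (fun e : ℝ => μ + e) 1 e := by simpa using (hasDerivAt_id e).const_add μ
    have := hd.comp e h2'
    rw [mul_one] at this
    exact this
  · exact klrf_continuousOn_invPertDt B hδ1 hδ hκ hκ₁ hlo hhi θ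
  · simp only [hneg]
    exact (perturbedFermiRadius_mem_Ioo B hδc hδ hlo.le (by linarith) θ).1
  · simp only [hneg]
    exact (klrf_level_mono_growth B hδ1 hδ hκ hκ₁ hlo.le hhi.le (by linarith) θ).1
  · intro t ht hnot
    refine klrf_ray_support B hδ1 hδ hκ hκ₁ hlo hhi hsupp ht ?_
    simpa only [hneg] using hnot

include B hδ1 hδ hκ hκ₁ in
/-- The level-coordinate integrand `e ↦ 𝒥_E(θ,e) • h(u_E(μ+e,θ)·(cos θ, sin θ))` is continuous on `[−ē, ē]` (hence interval-integrable). -/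
theorem klrg_level_integrand_continuousOn {h : ℝ × ℝ → E'} (hc : Continuous h) {μ ē : ℝ} (hlo : a < μ - ē - κ₀) (hhi : μ + ē + κ₀ < b)
    (θ : ℝ) :
    ContinuousOn (fun e : ℝ => (perturbedFermiRadius δ (μ + e) θ *
          (rayDispersionDt θ (perturbedFermiRadius δ (μ + e) θ) +
            fderiv ℝ δ (perturbedFermiRadius δ (μ + e) θ • dir θ) (dir θ))⁻¹) •
        h (perturbedFermiRadius δ (μ + e) θ * Real.cos θ, perturbedFermiRadius δ (μ + e) θ * Real.sin θ)) (Icc (-ē) ē) := by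
  have hu_on : ContinuousOn (fun e : ℝ => perturbedFermiRadius δ (μ + e) θ) (Icc (-ē) ē) := by
    intro e he
    have hA : ContinuousAt (fun ν : ℝ => perturbedFermiRadius δ ν θ) (μ + e) :=
      klrf_continuousAt_level B hδ1 hδ hκ hκ₁ (by linarith [he.1]) (by linarith [he.2]) θ
    have hB : Continuous (fun e : ℝ => μ + e) := by fun_prop
    exact (ContinuousAt.comp (f := fun e : ℝ => μ + e) (x := e) hA hB.continuousAt).continuousWithinAt
  have hinv := klrf_continuousOn_invPertDt B hδ1 hδ hκ hκ₁ hlo hhi θ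
  have hpt : ContinuousOn (fun e : ℝ => ((perturbedFermiRadius δ (μ + e) θ * Real.cos θ,
      perturbedFermiRadius δ (μ + e) θ * Real.sin θ) : ℝ × ℝ)) (Icc (-ē) ē) :=
    (hu_on.mul continuousOn_const).prodMk (hu_on.mul continuousOn_const)
  exact (hu_on.mul hinv).smul (hc.comp_continuousOn hpt)

variable {δ' : (Fin 2 → ℝ) → ℝ} (hδ'1 : ContDiff ℝ 1 δ') {η : ℝ}
  (hδ' : ∀ k : Fin 2 → ℝ, (∀ i, |k i| ≤ π) → |δ' k| ≤ κ₀)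
  (hκ' : ∀ k : Fin 2 → ℝ, (∀ i, |k i| ≤ π) → ‖fderiv ℝ δ' k‖ ≤ κ₁)
  (hη : ∀ k : Fin 2 → ℝ, (∀ i, |k i| ≤ π) → |δ k - δ' k| ≤ η)

include B hδ1 hδ'1 hδ hδ' hκ hκ' hκ₁ hη in
/-- **(Fb) THE PLANAR RE-FRAMING INEQUALITY.**  Two admissible frames `δ, δ′` (`|δ − δ′| ≤ η`, `|Dδ[dir θ] − Dδ′[dir θ]| ≤ η₁` on the closed square, radial
Lipschitz constant `κ₂` for `Dδ[dir θ]`), a margin window `a < μ − ē − κ₀`, `μ + ē + κ₀ < b`, and two continuous compactly supported planar integrands `h, h′`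
supported in the open square and in the respective tubes `|ε₀ + δ − μ| < ē`, `|ε₀ + δ′ − μ| < ē`, which are LEVEL-BUILT with the SAME profile `f`:
`h(t·(cos θ, sin θ)) = f θ (ε₀ + δ − μ)(t·dir θ) • F(t·(cos θ, sin θ))`, `h′(…) = f θ (ε₀ + δ′ − μ)(…) • F′(…)` (`t > 0`), where the non-level factors satisfy
`‖F‖ ≤ B_F`, `‖F p − F q‖ ≤ L_F‖p − q‖`, `‖F − F′‖ ≤ η_F`, and the profile has level mass `∫_{−ē}^{ē} |f θ e| de ≤ m_f` at every angle.  Then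
`‖∫ h − ∫ h′‖ ≤ 2π·m_f·(C_𝒥·B_F + (π√2/d)·(L_F·η/d + η_F))`, `C_𝒥 = (1/d² + π√2(2+κ₂)/d³)·η + (π√2/d²)·η₁`, `d = Dt_min − κ₁`:
the re-framing defect is ∝ the profile's own LEVEL MASS — the profile is never differentiated. -/
theorem klrg_integral_reframe_norm_sub_le {h h' : ℝ × ℝ → E'} (hc : Continuous h) (hcs : HasCompactSupport h)
    (hc' : Continuous h') (hcs' : HasCompactSupport h') {μ ē : ℝ} (hē : 0 ≤ ē) (hlo : a < μ - ē - κ₀) (hhi : μ + ē + κ₀ < b)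
    (hsupp : ∀ p : ℝ × ℝ, h p ≠ 0 → |p.1| < π ∧ |p.2| < π ∧ |sqDispersion ![p.1, p.2] + δ ![p.1, p.2] - μ| < ē)
    (hsupp' : ∀ p : ℝ × ℝ, h' p ≠ 0 → |p.1| < π ∧ |p.2| < π ∧ |sqDispersion ![p.1, p.2] + δ' ![p.1, p.2] - μ| < ē)
    {f : ℝ → ℝ → ℝ} {F F' : ℝ × ℝ → E'}
    (hfac : ∀ θ ∈ Ioo (-π) π, ∀ t, 0 < t →
      h (t * Real.cos θ, t * Real.sin θ) = f θ (rayDispersion (θ, t) + δ (t • dir θ) - μ) • F (t * Real.cos θ, t * Real.sin θ))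
    (hfac' : ∀ θ ∈ Ioo (-π) π, ∀ t, 0 < t →
      h' (t * Real.cos θ, t * Real.sin θ) = f θ (rayDispersion (θ, t) + δ' (t • dir θ) - μ) • F' (t * Real.cos θ, t * Real.sin θ))
    {κ₂ η₁ BF LF ηF mf : ℝ} (hκ₂ : 0 ≤ κ₂) (hBF : 0 ≤ BF) (hLF : 0 ≤ LF)
    (hD2 : ∀ θ s t : ℝ, s ∈ Icc 0 (π / ‖dir θ‖) → t ∈ Icc 0 (π / ‖dir θ‖) →
      |fderiv ℝ δ (s • dir θ) (dir θ) - fderiv ℝ δ (t • dir θ) (dir θ)| ≤ κ₂ * |s - t|)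
    (hη₁ : ∀ θ : ℝ, ∀ k : Fin 2 → ℝ, (∀ i, |k i| ≤ π) → |fderiv ℝ δ k (dir θ) - fderiv ℝ δ' k (dir θ)| ≤ η₁)
    (hFB : ∀ p, ‖F p‖ ≤ BF) (hFL : ∀ p q, ‖F p - F q‖ ≤ LF * ‖p - q‖) (hFF' : ∀ p, ‖F p - F' p‖ ≤ ηF)
    (hfi : ∀ θ ∈ Ioo (-π) π, IntervalIntegrable (f θ) volume (-ē) ē)
    (hmf : ∀ θ ∈ Ioo (-π) π, ∫ e in (-ē)..ē, |f θ e| ≤ mf) :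
    ‖(∫ p, h p) - ∫ p, h' p‖ ≤ 2 * π * (mf *
      (((1 / (B.Dtmin - κ₁) ^ 2 + Real.pi * Real.sqrt 2 * (2 + κ₂) / (B.Dtmin - κ₁) ^ 3) * η +
          Real.pi * Real.sqrt 2 / (B.Dtmin - κ₁) ^ 2 * η₁) * BF +
        Real.pi * Real.sqrt 2 / (B.Dtmin - κ₁) * (LF * (η / (B.Dtmin - κ₁)) + ηF))) := by
  have hδc : Continuous δ := hδ1.continuous
  have hδ'c : Continuous δ' := hδ'1.continuous
  set d := B.Dtmin - κ₁ with hd_def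
  have hd : 0 < d := by rw [hd_def]; linarith
  have hη0 : 0 ≤ η := (abs_nonneg _).trans (hη 0 (fun i => by simp [Real.pi_pos.le]))
  have hη₁0 : 0 ≤ η₁ := (abs_nonneg _).trans (hη₁ 0 0 (fun i => by simp [Real.pi_pos.le]))
  have hηF0 : 0 ≤ ηF := (norm_nonneg _).trans (hFF' 0)
  -- the constant
  set CJ := (1 / d ^ 2 + Real.pi * Real.sqrt 2 * (2 + κ₂) / d ^ 3) * η + Real.pi * Real.sqrt 2 / d ^ 2 * η₁ with hCJ_def
  set C := CJ * BF + Real.pi * Real.sqrt 2 / d * (LF * (η / d) + ηF) with hC_def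
  have hCJ0 : 0 ≤ CJ := by positivity
  have hC0 : 0 ≤ C := by positivity
  -- integrability of `h − h'`
  have hint : Integrable h := hc.integrable_of_hasCompactSupport hcs
  have hint' : Integrable h' := hc'.integrable_of_hasCompactSupport hcs'
  have hsub : (∫ p, h p) - ∫ p, h' p = ∫ p, (h - h') p := (integral_sub hint hint').symm
  rw [hsub]
  refine klry_norm_integral_le_of_ray_bound (hint.sub hint') (B := mf * C) (fun θ hθ => ?_)
  -- the ray of angle θ: split the two rays
  have hr : (∫ t in Ioi (0 : ℝ), t • (h - h') (t * Real.cos θ, t * Real.sin θ)) =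
      (∫ t in Ioi (0 : ℝ), t • h (t * Real.cos θ, t * Real.sin θ)) - ∫ t in Ioi (0 : ℝ), t • h' (t * Real.cos θ, t * Real.sin θ) := by
    rw [← integral_sub (klrg_ray_integrable hc hcs θ).integrableOn (klrg_ray_integrable hc' hcs' θ).integrableOn]
    simp only [Pi.sub_apply, smul_sub]
  rw [hr, klrg_ray_eq_level B hδ1 hδ hκ hκ₁ hc hē hlo hhi hsupp θ, klrg_ray_eq_level B hδ'1 hδ' hκ' hκ₁ hc' hē hlo hhi hsupp' θ]
  -- abbreviations along the ray
  set u : ℝ → ℝ := fun e => perturbedFermiRadius δ (μ + e) θ with hu_def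
  set u' : ℝ → ℝ := fun e => perturbedFermiRadius δ' (μ + e) θ with hu'_def
  set J : ℝ → ℝ := fun e => u e * (rayDispersionDt θ (u e) + fderiv ℝ δ (u e • dir θ) (dir θ))⁻¹ with hJ_def
  set J' : ℝ → ℝ := fun e => u' e * (rayDispersionDt θ (u' e) + fderiv ℝ δ' (u' e • dir θ) (dir θ))⁻¹ with hJ'_def
  set G : ℝ → E' := fun e => J e • h (u e * Real.cos θ, u e * Real.sin θ) with hG_def
  set G' : ℝ → E' := fun e => J' e • h' (u' e * Real.cos θ, u' e * Real.sin θ) with hG'_def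
  change ‖(∫ e in (-ē)..ē, G e) - ∫ e in (-ē)..ē, G' e‖ ≤ mf * C
  have hGi : IntervalIntegrable G volume (-ē) ē := by
    refine (ContinuousOn.intervalIntegrable ?_)
    rw [uIcc_of_le (by linarith)]
    exact klrg_level_integrand_continuousOn B hδ1 hδ hκ hκ₁ hc hlo hhi θ
  have hG'i : IntervalIntegrable G' volume (-ē) ē := by
    refine (ContinuousOn.intervalIntegrable ?_)
    rw [uIcc_of_le (by linarith)]
    exact klrg_level_integrand_continuousOn B hδ'1 hδ' hκ' hκ₁ hc' hlo hhi θ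
  rw [← intervalIntegral.integral_sub hGi hG'i]
  -- pointwise bound on `[−ē, ē]`
  have hpt : ∀ e ∈ Icc (-ē) ē, ‖G e - G' e‖ ≤ |f θ e| * C := by
    intro e he
    have hν : a ≤ μ + e - κ₀ := by linarith [he.1]
    have hν' : μ + e + κ₀ ≤ b := by linarith [he.2]
    have hupos : 0 < u e := (perturbedFermiRadius_mem_Ioo B hδc hδ hν hν' θ).1
    have hu'pos : 0 < u' e := (perturbedFermiRadius_mem_Ioo B hδ'c hδ' hν hν' θ).1
    -- the level along each frame's own curve is `e`
    have hlev : rayDispersion (θ, u e) + δ (u e • dir θ) - μ = e := by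
      have := sqDispersion_add_perturbedFermiRadius B hδc hδ hν hν' θ
      change sqDispersion (u e • dir θ) + δ (u e • dir θ) = μ + e at this
      have hray : rayDispersion (θ, u e) = sqDispersion (u e • dir θ) := rfl
      rw [hray]; linarith
    have hlev' : rayDispersion (θ, u' e) + δ' (u' e • dir θ) - μ = e := by
      have := sqDispersion_add_perturbedFermiRadius B hδ'c hδ' hν hν' θ
      change sqDispersion (u' e • dir θ) + δ' (u' e • dir θ) = μ + e at this
      have hray : rayDispersion (θ, u' e) = sqDispersion (u' e • dir θ) := rfl
      rw [hray]; linarith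
    have hh : h (u e * Real.cos θ, u e * Real.sin θ) = f θ e • F (u e * Real.cos θ, u e * Real.sin θ) := by
      rw [hfac θ hθ (u e) hupos, hlev]
    have hh' : h' (u' e * Real.cos θ, u' e * Real.sin θ) = f θ e • F' (u' e * Real.cos θ, u' e * Real.sin θ) := by
      rw [hfac' θ hθ (u' e) hu'pos, hlev']
    -- the three motions
    have hJJ : |J e - J' e| ≤ CJ :=
      klrg_jacobian_reframe B hδ1 hδ'1 hδ hδ' hκ hκ' hκ₁ hη hκ₂ (hD2 θ) (hη₁ θ) hν hν'
    have hJ'0 : 0 ≤ J' e := klrj_jacobian_nonneg B hδ' hκ' hκ₁ hδ'c hν hν' θ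
    have hJ'le : J' e ≤ Real.pi * Real.sqrt 2 / d := klrj_jacobian_le B hδ' hκ' hκ₁ hδ'c hν hν' θ
    have hpp : ‖((u' e * Real.cos θ, u' e * Real.sin θ) : ℝ × ℝ) - (u e * Real.cos θ, u e * Real.sin θ)‖ ≤ η / d :=
      klrg_point_reframe B hδ1 hδ'1 hδ hδ' hκ hκ₁ hη hν hν' θ
    set p : ℝ × ℝ := (u e * Real.cos θ, u e * Real.sin θ) with hp_def
    set p' : ℝ × ℝ := (u' e * Real.cos θ, u' e * Real.sin θ) with hp'_def
    have hFF : ‖F p - F' p'‖ ≤ LF * (η / d) + ηF := by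
      calc ‖F p - F' p'‖ = ‖(F p - F p') + (F p' - F' p')‖ := by congr 1; abel
        _ ≤ ‖F p - F p'‖ + ‖F p' - F' p'‖ := norm_add_le _ _
        _ ≤ LF * ‖p - p'‖ + ηF := add_le_add (hFL p p') (hFF' p')
        _ ≤ LF * (η / d) + ηF := by
            have : ‖p - p'‖ ≤ η / d := by rw [norm_sub_rev]; exact hpp
            nlinarith
    have hcore : ‖J e • F p - J' e • F' p'‖ ≤ C := by
      have hsplit : J e • F p - J' e • F' p' = (J e - J' e) • F p + J' e • (F p - F' p') := by
        rw [sub_smul, smul_sub]; abel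
      rw [hsplit]
      calc ‖(J e - J' e) • F p + J' e • (F p - F' p')‖ ≤ ‖(J e - J' e) • F p‖ + ‖J' e • (F p - F' p')‖ := norm_add_le _ _
        _ = |J e - J' e| * ‖F p‖ + J' e * ‖F p - F' p'‖ := by
            rw [norm_smul, norm_smul, Real.norm_eq_abs, Real.norm_eq_abs, abs_of_nonneg hJ'0]
        _ ≤ CJ * BF + Real.pi * Real.sqrt 2 / d * (LF * (η / d) + ηF) :=
            add_le_add (mul_le_mul hJJ (hFB p) (norm_nonneg _) hCJ0) (mul_le_mul hJ'le hFF (norm_nonneg _) (by positivity))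
    calc ‖G e - G' e‖ = ‖f θ e • (J e • F p - J' e • F' p')‖ := by
          simp only [hG_def, hG'_def]
          rw [hh, hh', smul_comm (J e) (f θ e), smul_comm (J' e) (f θ e), ← smul_sub]
      _ = |f θ e| * ‖J e • F p - J' e • F' p'‖ := by rw [norm_smul, Real.norm_eq_abs]
      _ ≤ |f θ e| * C := mul_le_mul_of_nonneg_left hcore (abs_nonneg _)
  -- integrate the pointwise bound
  have hbound : IntervalIntegrable (fun e => |f θ e| * C) volume (-ē) ē := (hfi θ hθ).abs.mul_const C
  calc ‖∫ e in (-ē)..ē, G e - G' e‖ ≤ ∫ e in (-ē)..ē, |f θ e| * C :=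
        intervalIntegral.norm_integral_le_of_norm_le (by linarith) (Filter.Eventually.of_forall fun e he => hpt e (Ioc_subset_Icc_self he)) hbound
    _ = (∫ e in (-ē)..ē, |f θ e|) * C := intervalIntegral.integral_mul_const C _
    _ ≤ mf * C := mul_le_mul_of_nonneg_right (hmf θ hθ) hC0

end Planar

/-! ## §2 (appended) (Fc) The lattice twin: two torus averages differ by the planar defect + two Riemann terms -/

section Lattice

open MeasureTheory Literature.Probability.LatticeModels
open scoped NNReal

variable {E' : Type*} [NormedAddCommGroup E'] [NormedSpace ℝ E'] [CompleteSpace E']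

/-- **(Fc) TWO TORUS AVERAGES** (model carrier, one Matsubara frequency): if `F, F′ : ℝ × ℝ → E` are continuous, doubly `2π`-periodic, Lipschitz with constants `K`, `K′`,
agree on the closed square with `h, h′` which vanish off it, then
`‖L⁻²·Σ_k F(2πk/L) − L⁻²·Σ_k F′(2πk/L)‖ ≤ 2π(K + K′)/L + (2π)⁻²·‖∫h − ∫h′‖` — the planar re-framing defect of `klrg_integral_reframe_norm_sub_le` plus two Riemann
terms (`klfl_latticeAverage_sub_planar_integral_norm_le`, p489318). -/
theorem klrg_latticeAverage_reframe_norm_sub_le {F F' h h' : ℝ × ℝ → E'} (hF : Continuous F) (hF' : Continuous F')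
    (h1 : ∀ x y, F (x + 2 * π, y) = F (x, y)) (h2 : ∀ x y, F (x, y + 2 * π) = F (x, y))
    (h1' : ∀ x y, F' (x + 2 * π, y) = F' (x, y)) (h2' : ∀ x y, F' (x, y + 2 * π) = F' (x, y))
    {K K' : ℝ≥0} (hlip : ∀ p q : ℝ × ℝ, ‖F p - F q‖ ≤ K * dist p q) (hlip' : ∀ p q : ℝ × ℝ, ‖F' p - F' q‖ ≤ K' * dist p q)
    (hFh : ∀ p ∈ Icc (-π) π ×ˢ Icc (-π) π, F p = h p) (hh0 : ∀ p ∉ Icc (-π) π ×ˢ Icc (-π) π, h p = 0)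
    (hFh' : ∀ p ∈ Icc (-π) π ×ˢ Icc (-π) π, F' p = h' p) (hh0' : ∀ p ∉ Icc (-π) π ×ˢ Icc (-π) π, h' p = 0)
    (L : ℕ) [NeZero L] :
    ‖((L ^ 2 : ℕ) : ℝ)⁻¹ • ∑ k : TorusSite 2 L, F (latticeMomentum L k 0, latticeMomentum L k 1) -
        ((L ^ 2 : ℕ) : ℝ)⁻¹ • ∑ k : TorusSite 2 L, F' (latticeMomentum L k 0, latticeMomentum L k 1)‖ ≤
      2 * π * K / L + 2 * π * K' / L + ((2 * π) ^ 2)⁻¹ * ‖(∫ p, h p) - ∫ p, h' p‖ := by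
  set a := ((L ^ 2 : ℕ) : ℝ)⁻¹ • ∑ k : TorusSite 2 L, F (latticeMomentum L k 0, latticeMomentum L k 1) with ha
  set a' := ((L ^ 2 : ℕ) : ℝ)⁻¹ • ∑ k : TorusSite 2 L, F' (latticeMomentum L k 0, latticeMomentum L k 1) with ha'
  set b : E' := ((2 * π) ^ 2)⁻¹ • ∫ p, h p with hb
  set b' : E' := ((2 * π) ^ 2)⁻¹ • ∫ p, h' p with hb'
  have hab : ‖a - b‖ ≤ 2 * π * K / L := klfl_latticeAverage_sub_planar_integral_norm_le hF h1 h2 hlip hFh hh0 L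
  have hab' : ‖a' - b'‖ ≤ 2 * π * K' / L := klfl_latticeAverage_sub_planar_integral_norm_le hF' h1' h2' hlip' hFh' hh0' L
  have hbb : ‖b - b'‖ = ((2 * π) ^ 2)⁻¹ * ‖(∫ p, h p) - ∫ p, h' p‖ := by
    rw [hb, hb', ← smul_sub, norm_smul, norm_inv, norm_pow, Real.norm_eq_abs, abs_of_pos (by positivity)]
  calc ‖a - a'‖ = ‖(a - b) + (b - b') - (a' - b')‖ := by congr 1; abel
    _ ≤ ‖a - b‖ + ‖b - b'‖ + ‖a' - b'‖ := norm_sub_le_of_le (norm_add_le _ _) le_rfl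
    _ ≤ 2 * π * K / L + ((2 * π) ^ 2)⁻¹ * ‖(∫ p, h p) - ∫ p, h' p‖ + 2 * π * K' / L := by rw [hbb]; linarith
    _ = 2 * π * K / L + 2 * π * K' / L + ((2 * π) ^ 2)⁻¹ * ‖(∫ p, h p) - ∫ p, h' p‖ := by ring

/-- **(Fc) MATSUBARA-SUMMED** (model carrier `MatsubaraIdx M × TorusSite 2 L`): for two families `F_i, F′_i` as above (common Lipschitz constants `K, K′`, both
vanishing for `|ω_i| ≥ r`), with the planar defects summed `‖β⁻¹•Σ_i (∫h_i − ∫h′_i)‖ ≤ D`: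
`‖β⁻¹•Σ_i L⁻²Σ_k F_i(2πk/L) − β⁻¹•Σ_i L⁻²Σ_k F′_i(2πk/L)‖ ≤ (2π)⁻²·D + (r/π + 3/β)·2π(K + K′)/L`
(`klfl_matsubara_latticeAverage_norm_le` applied to the difference family). -/
theorem klrg_matsubara_latticeAverage_reframe_norm_sub_le {M : ℕ} {F F' h h' : MatsubaraIdx M → ℝ × ℝ → E'} {K K' : ℝ≥0} {D r β : ℝ}
    (hβ : 0 < β) (hr : 0 ≤ r) (hF : ∀ i, Continuous (F i)) (hF' : ∀ i, Continuous (F' i))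
    (h1 : ∀ i x y, F i (x + 2 * π, y) = F i (x, y)) (h2 : ∀ i x y, F i (x, y + 2 * π) = F i (x, y))
    (h1' : ∀ i x y, F' i (x + 2 * π, y) = F' i (x, y)) (h2' : ∀ i x y, F' i (x, y + 2 * π) = F' i (x, y))
    (hlip : ∀ i (p q : ℝ × ℝ), ‖F i p - F i q‖ ≤ K * dist p q) (hlip' : ∀ i (p q : ℝ × ℝ), ‖F' i p - F' i q‖ ≤ K' * dist p q)
    (hFh : ∀ i, ∀ p ∈ Icc (-π) π ×ˢ Icc (-π) π, F i p = h i p) (hh0 : ∀ i, ∀ p ∉ Icc (-π) π ×ˢ Icc (-π) π, h i p = 0)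
    (hFh' : ∀ i, ∀ p ∈ Icc (-π) π ×ˢ Icc (-π) π, F' i p = h' i p) (hh0' : ∀ i, ∀ p ∉ Icc (-π) π ×ˢ Icc (-π) π, h' i p = 0)
    (hzero : ∀ i, r ≤ |matsubaraFreq β M i| → ∀ p, F i p = 0) (hzero' : ∀ i, r ≤ |matsubaraFreq β M i| → ∀ p, F' i p = 0)
    (hhi : ∀ i, Integrable (h i)) (hhi' : ∀ i, Integrable (h' i))
    (hD : ‖β⁻¹ • ∑ i : MatsubaraIdx M, ((∫ p, h i p) - ∫ p, h' i p)‖ ≤ D) (L : ℕ) [NeZero L] :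
    ‖β⁻¹ • ∑ i : MatsubaraIdx M, ((L ^ 2 : ℕ) : ℝ)⁻¹ • ∑ k : TorusSite 2 L, F i (latticeMomentum L k 0, latticeMomentum L k 1) -
        β⁻¹ • ∑ i : MatsubaraIdx M, ((L ^ 2 : ℕ) : ℝ)⁻¹ • ∑ k : TorusSite 2 L, F' i (latticeMomentum L k 0, latticeMomentum L k 1)‖ ≤
      ((2 * π) ^ 2)⁻¹ * D + (r / π + 3 / β) * (2 * π * (K + K') / L) := by
  -- the difference family
  have hG : ∀ i, Continuous (fun p => F i p - F' i p) := fun i => (hF i).sub (hF' i)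
  have key := klfl_matsubara_latticeAverage_norm_le (E := E') (F := fun i p => F i p - F' i p) (h := fun i p => h i p - h' i p)
    (K := K + K') (B := D) hβ hr hG
    (fun i x y => by simp only [h1 i, h1' i]) (fun i x y => by simp only [h2 i, h2' i])
    (fun i p q => by
      calc ‖F i p - F' i p - (F i q - F' i q)‖ = ‖(F i p - F i q) - (F' i p - F' i q)‖ := by congr 1; abel
        _ ≤ ‖F i p - F i q‖ + ‖F' i p - F' i q‖ := norm_sub_le _ _
        _ ≤ K * dist p q + K' * dist p q := add_le_add (hlip i p q) (hlip' i p q)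
        _ = ((K + K' : ℝ≥0) : ℝ) * dist p q := by push_cast; ring)
    (fun i p hp => by simp only [hFh i p hp, hFh' i p hp]) (fun i p hp => by simp only [hh0 i p hp, hh0' i p hp, sub_self])
    (fun i hi p => by simp only [hzero i hi p, hzero' i hi p, sub_self]) ?_ L
  · have e1 : ∀ i, ((L ^ 2 : ℕ) : ℝ)⁻¹ • ∑ k : TorusSite 2 L, (F i (latticeMomentum L k 0, latticeMomentum L k 1) -
          F' i (latticeMomentum L k 0, latticeMomentum L k 1)) =
        ((L ^ 2 : ℕ) : ℝ)⁻¹ • ∑ k : TorusSite 2 L, F i (latticeMomentum L k 0, latticeMomentum L k 1) -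
          ((L ^ 2 : ℕ) : ℝ)⁻¹ • ∑ k : TorusSite 2 L, F' i (latticeMomentum L k 0, latticeMomentum L k 1) := by
      intro i; rw [Finset.sum_sub_distrib, smul_sub]
    rw [← smul_sub, ← Finset.sum_sub_distrib]
    simp only [← e1]
    exact key
  · have e2 : ∀ i, (∫ p, (h i p - h' i p)) = (∫ p, h i p) - ∫ p, h' i p := fun i => integral_sub (hhi i) (hhi' i)
    simp only [e2]
    exact hD

end Lattice

end Summit.HubbardSuperconductivity.HubbardSuperconductivity.Theorems.KLRegimeSplit

end
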